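import Literature.Topology.FourManifolds.PlanarBandFamily
import HarnessLib

/-!
# The finger move of the handle slide: pushing the attaching circle into the band along graphs

Topic `Literature/Topology/FourManifolds`; fact seat `provefact-IsStrictHandleSlide.isSurgery`
(R. C. Kirby, *The Topology of 4-Manifolds*, LNM 1374 (1989), Ch. I §4, p. 10: the slid circle is
the band-connected sum of `Kᵢ` with the push-off `Kⱼ'`, obtained by pushing an arc of `Kᵢ` along
the band — the "finger"; remaining content in the tree: the named fact (S)
`Literature.Topology.FourManifolds.FramedLink.IsStrictHandleSlide.slideModel`,
`KirbyMovesHandleSlide.lean`). The finger move of the tree's proof programme is the simplest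
possible planar family in the band (`BandData.PlanarFamily`, `PlanarBandFamily.lean`): if the
loop to be reached is the band image of a **graph over the height** `x₀ = ρ`, the tracks
`(u ρ(t), h(t))`, `u ∈ [0, 1]`, interpolate between the left edge (`u = 0`, the arc of `Kᵢ = A`)
and the loop (`u = 1`) through embedded graphs. Proved here (no definitions, no named facts):

* `Literature.Topology.FourManifolds.BandData.planarFamily_edgeGraph` — for band data `b` of
  `(A, B, K)` and a smooth `ρ : ℝ → ℝ` with `0 ≤ ρ < 1 + δ`, vanishing off an interval
  `(s₁', s₂')` of parameters of `A` inside the left-edge window `(thetaA (3/20), thetaA (17/20))`,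
  the family `P u t = (u ρ t, fLo t)` (`fLo` = the height of `A` along the left edge, extended,
  `BandRebuildArches.lean`) is a planar family in the band for the knot `A` over
  `S = [thetaA (3/20), thetaA (17/20)]`; hence (`PlanarFamily.isModification.exists_ambientIsotopy`,
  `PlanarFamily.outKnot_circlePt_of_mem`) `A` is ambient isotopic, with support in any open set
  containing the band images of the tracks, to the knot which is `band (ρ t, fLo t)` over `S` and
  `A` elsewhere (`exists_ambientIsotopy_edgeGraph`).

## References

* R. C. Kirby, *The Topology of 4-Manifolds*, LNM 1374, Springer (1989), Ch. I §4. [Kirby1989]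
* M. W. Hirsch, *Differential Topology*, GTM 33, Springer (1976), Ch. 8 §1, Thm. 1.3. [HirschDT1976]
-/

open scoped Manifold ContDiff Topology
open Function Set Metric

noncomputable section

namespace Literature.Topology.FourManifolds

namespace BandData

variable {A B K : Knot} {avoid : Set (Metric.sphere (0 : EuclideanSpace ℝ (Fin 4)) 1)}
  (b : BandData A B K avoid)

/-- The collar parameter of the finger family: half the smaller of the two gaps between the window
`[thetaA (3/20), thetaA (17/20)]` and the ends of the fundamental domain
`[thetaA (1/10), thetaA (1/10) + 1)`. (An expression, recorded as a lemma: it is positive.)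
[folklore] -/
theorem fingerEps_pos : 0 < min (b.thetaA (3 / 20) - b.thetaA 10⁻¹)
    (b.thetaA 10⁻¹ + 1 - b.thetaA (17 / 20)) / 2 := by
  have h1 : b.thetaA 10⁻¹ < b.thetaA (3 / 20) :=
    b.strictMonoOn_thetaA (by norm_num) (by norm_num) (by norm_num)
  have h2 : b.thetaA (17 / 20) < b.thetaA (9 / 10) :=
    b.strictMonoOn_thetaA (by norm_num) (by norm_num) (by norm_num)
  have h3 := b.thetaA_window
  have : 0 < min (b.thetaA (3 / 20) - b.thetaA 10⁻¹) (b.thetaA 10⁻¹ + 1 - b.thetaA (17 / 20)) :=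
    lt_min (by linarith) (by linarith)
  linarith

/-- `fLo = heightA` on the window `[thetaA (3/20), thetaA (17/20)]`, and the height there lies in
`[3/20, 17/20]`. [folklore] -/
theorem fLo_eq_heightA_window {t : ℝ} (ht : t ∈ Icc (b.thetaA (3 / 20)) (b.thetaA (17 / 20))) :
    b.fLo t = b.heightA t ∧ b.heightA t ∈ Icc (3 / 20 : ℝ) (17 / 20) := by
  have h1 := b.fLo_spec.2.1 t ht
  refine ⟨h1, ?_⟩
  have hlo : b.thetaA 10⁻¹ ≤ b.thetaA (3 / 20) :=
    (b.strictMonoOn_thetaA (by norm_num) (by norm_num) (by norm_num)).le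
  have hhi : b.thetaA (17 / 20) ≤ b.thetaA (9 / 10) :=
    (b.strictMonoOn_thetaA (by norm_num) (by norm_num) (by norm_num)).le
  have hmono := b.strictMonoOn_heightA.monotoneOn
  have ha : b.heightA (b.thetaA (3 / 20)) = 3 / 20 := b.heightA_thetaA (by norm_num)
  have hb' : b.heightA (b.thetaA (17 / 20)) = 17 / 20 := b.heightA_thetaA (by norm_num)
  constructor
  · rw [← ha]
    exact hmono ⟨hlo, by linarith [ht.1, ht.2, hhi]⟩ ⟨hlo.trans ht.1, ht.2.trans hhi⟩ ht.1
  · rw [← hb']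
    exact hmono ⟨hlo.trans ht.1, ht.2.trans hhi⟩ ⟨by linarith [ht.1, ht.2, hlo], hhi⟩ ht.2

/-- **The finger family is a planar family in the band.** See the module docstring.
[cite: Kirby1989, Ch. I §4] -/
theorem planarFamily_edgeGraph {ρ : ℝ → ℝ} (hρ : ContDiff ℝ ∞ ρ) {s₁' s₂' : ℝ}
    (h1 : b.thetaA (3 / 20) < s₁') (h12 : s₁' < s₂') (h2 : s₂' < b.thetaA (17 / 20))
    (hρ0 : ∀ t, t ∉ Ioo s₁' s₂' → ρ t = 0) (hρnn : ∀ t, 0 ≤ ρ t) (hρlt : ∀ t, ρ t < 1 + b.δ) :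
    b.PlanarFamily A (b.thetaA 10⁻¹)
      (min (b.thetaA (3 / 20) - b.thetaA 10⁻¹) (b.thetaA 10⁻¹ + 1 - b.thetaA (17 / 20)) / 2)
      (b.thetaA (3 / 20)) s₁' s₂' (b.thetaA (17 / 20))
      (fun u t ↦ pt2 (u * ρ t) (b.fLo t)) := by
  have hδ := b.δ_pos
  have hε := b.fingerEps_pos
  set ε := min (b.thetaA (3 / 20) - b.thetaA 10⁻¹) (b.thetaA 10⁻¹ + 1 - b.thetaA (17 / 20)) / 2
    with hε_def
  have hεle1 : ε ≤ (b.thetaA (3 / 20) - b.thetaA 10⁻¹) / 2 := by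
    have := min_le_left (b.thetaA (3 / 20) - b.thetaA 10⁻¹) (b.thetaA 10⁻¹ + 1 - b.thetaA (17 / 20))
    simp only [hε_def]; linarith
  have hεle2 : ε ≤ (b.thetaA 10⁻¹ + 1 - b.thetaA (17 / 20)) / 2 := by
    have := min_le_right (b.thetaA (3 / 20) - b.thetaA 10⁻¹) (b.thetaA 10⁻¹ + 1 - b.thetaA (17 / 20))
    simp only [hε_def]; linarith
  have hw1 : b.thetaA 10⁻¹ < b.thetaA (3 / 20) :=
    b.strictMonoOn_thetaA (by norm_num) (by norm_num) (by norm_num)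
  have hw2 : b.thetaA (17 / 20) < b.thetaA (9 / 10) :=
    b.strictMonoOn_thetaA (by norm_num) (by norm_num) (by norm_num)
  have hwin := b.thetaA_window
  -- the window lies in the parameter interval of the left lift
  have hSsub : Icc (b.thetaA (3 / 20)) (b.thetaA (17 / 20)) ⊆ Icc (b.thetaA 10⁻¹) (b.thetaA (9 / 10)) :=
    Icc_subset_Icc hw1.le hw2.le
  -- smoothness of the family
  have hfLo : ContDiff ℝ ∞ b.fLo := b.fLo_spec.1
  have hPs : ContDiff ℝ ∞ (uncurry fun u t ↦ pt2 (u * ρ t) (b.fLo t)) := by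
    have h0 : ContDiff ℝ ∞ fun p : ℝ × ℝ ↦ p.1 * ρ p.2 := contDiff_fst.mul (hρ.comp contDiff_snd)
    have h1' : ContDiff ℝ ∞ fun p : ℝ × ℝ ↦ b.fLo p.2 := hfLo.comp contDiff_snd
    rw [show (uncurry fun u t ↦ pt2 (u * ρ t) (b.fLo t)) = fun p : ℝ × ℝ ↦ pt2 (p.1 * ρ p.2) (b.fLo p.2)
      from rfl]
    rw [contDiff_euclidean]
    intro i
    fin_cases i
    · exact h0
    · exact h1'
  -- positivity of `fLo'` on the window and strict monotonicity
  have hfLo' : ∀ t, t ≤ b.thetaA (17 / 20) → 0 < deriv b.fLo t := b.fLo_spec.2.2.1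
  have hmono : StrictMonoOn b.fLo (Iic (b.thetaA (17 / 20))) := by
    refine strictMonoOn_of_deriv_pos (convex_Iic _) hfLo.continuous.continuousOn fun x hx ↦ ?_
    rw [interior_Iic] at hx
    exact hfLo' x hx.le
  refine
    { ε_pos := hε
      hs := ⟨by linarith, h1, h12, h2, by linarith⟩
      contDiff := hPs
      eq_zero := fun u t ht ↦ ?_
      curve_eq := fun s hs ↦ ?_
      mem := fun u hu s hs ↦ ?_
      deriv_ne := fun u hu s hs ↦ ?_
      injOn := fun u hu ↦ ?_
      disjoint := fun u hu s hs t ht hts ↦ ?_ }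
  · -- off the inner interval nothing moves
    simp only [hρ0 t ht, mul_zero]
  · -- on `S` the knot `A` is the band image of the left-edge track
    obtain ⟨hfs, -⟩ := b.fLo_eq_heightA_window hs
    simp only [zero_mul]
    rw [Knot.curve_apply, hfs, b.band_pt2_zero_heightA (hSsub hs)]
  · -- the tracks stay in the square neighbourhood
    obtain ⟨hfs, hhs⟩ := b.fLo_eq_heightA_window hs
    intro i
    fin_cases i
    · show u * ρ s ∈ Ioo (-b.δ) (1 + b.δ)
      have := hρnn s
      have := hρlt s
      constructor <;> nlinarith [hu.1, hu.2]
    · show b.fLo s ∈ Ioo (-b.δ) (1 + b.δ)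
      rw [hfs]
      exact ⟨by linarith [hhs.1], by linarith [hhs.2]⟩
  · -- regularity: the height has positive derivative
    intro hd
    have hdiff : DifferentiableAt ℝ (fun t ↦ pt2 (u * ρ t) (b.fLo t)) s :=
      ((hPs.comp (contDiff_const.prodMk contDiff_id)).differentiable (by simp)) s
    have hcomp := congrArg (fun w : EuclideanSpace ℝ (Fin 2) ↦ w 1) hd
    have h1c : deriv (fun t ↦ pt2 (u * ρ t) (b.fLo t)) s 1 = deriv b.fLo s := by
      have hρd : HasDerivAt (fun t ↦ u * ρ t) (u * deriv ρ s) s :=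
        ((hρ.differentiable (by simp)) s).hasDerivAt.const_mul u
      have hfd : HasDerivAt b.fLo (deriv b.fLo s) s := ((hfLo.differentiable (by simp)) s).hasDerivAt
      rw [(hasDerivAt_pt2 hρd hfd).deriv]
      rfl
    rw [h1c] at hcomp
    simp only [PiLp.zero_apply] at hcomp
    exact (hfLo' s hs.2).ne' hcomp
  · -- injectivity: the height is strictly increasing on `S`
    intro s hs s' hs' he
    have hh : b.fLo s = b.fLo s' := by
      have := congrArg (fun w : EuclideanSpace ℝ (Fin 2) ↦ w 1) he
      exact this
    exact (hmono.injOn (mem_Iic.2 hs.2) (mem_Iic.2 hs'.2)) hh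
  · -- the band images avoid the rest of `A`
    obtain ⟨hfs, hhs⟩ := b.fLo_eq_heightA_window hs
    intro heq
    by_cases h0 : u * ρ s = 0
    · -- on the left edge: the point is `A (circlePt s)` with `s ≠ t (mod 1)`
      have hpt : b.band (pt2 (u * ρ s) (b.fLo s)) = A (circlePt s) := by
        rw [h0, hfs, b.band_pt2_zero_heightA (hSsub hs)]
      rw [hpt, ← Knot.curve_apply] at heq
      have hinj : circlePt s = circlePt t := by
        have := A.injective (Subtype.ext heq)
        exact this
      obtain ⟨m, hm⟩ := circlePt_eq_circlePt_iff.1 hinj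
      -- `s ∈ [a + ε, a + 1 - ε]`, `t ∈ [a, a + 1)` ⇒ `m = 0` ⇒ `t = s ∈ S`
      have hs1 : b.thetaA 10⁻¹ < s := by linarith [hs.1]
      have hs2 : s < b.thetaA 10⁻¹ + 1 := by linarith [hs.2]
      have hm1 : (m : ℝ) < 1 := by linarith [ht.1]
      have hm2 : (-1 : ℝ) < m := by linarith [ht.2]
      have hm1' : m < 1 := by exact_mod_cast hm1
      have hm2' : -1 < m := by exact_mod_cast hm2
      obtain rfl : m = 0 := by omega
      simp only [Int.cast_zero, add_zero] at hm
      exact hts (hm ▸ hs)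
    · -- off the left edge: not a point of `A`
      have hmem : pt2 (u * ρ s) (b.fLo s) ∈ squareNhd b.δ := by
        intro i
        fin_cases i
        · show u * ρ s ∈ Ioo (-b.δ) (1 + b.δ)
          have := hρnn s
          have := hρlt s
          constructor <;> nlinarith [hu.1, hu.2]
        · show b.fLo s ∈ Ioo (-b.δ) (1 + b.δ)
          rw [hfs]
          exact ⟨by linarith [hhs.1], by linarith [hhs.2]⟩
      have hnot := b.band_not_mem_range_A hmem h0
      exact hnot ⟨circlePt t, Subtype.ext (by rw [← Knot.curve_apply]; exact heq.symm)⟩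

/-- **The finger move as an ambient isotopy with support.** Under the hypotheses of
`planarFamily_edgeGraph`, for every open `O ⊆ S³` containing all band images
`band (u ρ t, fLo t)`, `u ∈ [0, 1]`, `t ∈ S = [thetaA (3/20), thetaA (17/20)]`, there is an ambient
isotopy `Θ` of `S³`, all of whose stages are the identity off `O`, whose end carries `A` to the
knot `k₁` with `k₁ (circlePt s) = band (ρ s, fLo s)` for `s ∈ S` and `k₁ (circlePt t) = A (circlePt t)`
for `t ∈ [thetaA (1/10), thetaA (1/10) + 1) ∖ S`. Hirsch (1976), Ch. 8 §1, Thm. 1.3.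
[cite: HirschDT1976, Ch. 8 §1, Thm. 1.3] -/
theorem exists_ambientIsotopy_edgeGraph {ρ : ℝ → ℝ} (hρ : ContDiff ℝ ∞ ρ) {s₁' s₂' : ℝ}
    (h1 : b.thetaA (3 / 20) < s₁') (h12 : s₁' < s₂') (h2 : s₂' < b.thetaA (17 / 20))
    (hρ0 : ∀ t, t ∉ Ioo s₁' s₂' → ρ t = 0) (hρnn : ∀ t, 0 ≤ ρ t) (hρlt : ∀ t, ρ t < 1 + b.δ)
    {O : Set (Metric.sphere (0 : EuclideanSpace ℝ (Fin 4)) 1)} (hO : IsOpen O)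
    (hOsub : ∀ u ∈ Icc (0 : ℝ) 1, ∀ s ∈ Icc (b.thetaA (3 / 20)) (b.thetaA (17 / 20)),
      b.band (pt2 (u * ρ s) (b.fLo s)) ∈ O) :
    ∃ (Θ : AmbientIsotopy (𝓡 3) (Metric.sphere (0 : EuclideanSpace ℝ (Fin 4)) 1)) (k₁ : Knot),
      (∀ t y, y ∉ O → Θ.toFun t y = y) ∧ Θ.toFun 1 ∘ A = k₁ ∧
      (∀ s ∈ Icc (b.thetaA (3 / 20)) (b.thetaA (17 / 20)), k₁ (circlePt s) = b.band (pt2 (ρ s) (b.fLo s))) ∧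
      (∀ t ∈ Ico (b.thetaA 10⁻¹) (b.thetaA 10⁻¹ + 1), t ∉ Icc (b.thetaA (3 / 20)) (b.thetaA (17 / 20)) →
        k₁ (circlePt t) = A (circlePt t)) := by
  have hP := b.planarFamily_edgeGraph hρ h1 h12 h2 hρ0 hρnn hρlt
  have hGO : ∀ y : Metric.sphere (0 : EuclideanSpace ℝ (Fin 4)) 1, y ∉ O → ∀ u ∈ Icc (0 : ℝ) 1,
      ∀ s ∈ Icc (b.thetaA (3 / 20)) (b.thetaA (17 / 20)), (y : EuclideanSpace ℝ (Fin 4)) ≠ hP.fam u s := by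
    intro y hy u hu s hs he
    rw [hP.fam_of_mem u hs] at he
    have hmem := hOsub u hu s hs
    have : y = b.band (pt2 (u * ρ s) (b.fLo s)) := Subtype.ext he
    exact hy (this ▸ hmem)
  obtain ⟨Θ, hΘO, hΘ, -⟩ := hP.isModification.exists_ambientIsotopy hO hGO
  refine ⟨Θ, hP.outKnot, hΘO, hΘ 1 ⟨zero_le_one, le_rfl⟩, fun s hs ↦ ?_, fun t ht hts ↦ ?_⟩
  · rw [hP.outKnot_circlePt_of_mem hs, one_mul]
  · exact hP.outKnot_circlePt_of_not_mem ht hts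

end BandData

end Literature.Topology.FourManifolds
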